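import Summits.MatrixMultiplication.OmegaCensus.STPP222Pow8From530A

/-!
# ω-census, `N₈ ≤ 257` — part C: kernel route decision, exponents `193 … 215`

HONEST FRAMING (pub-omega census; verbatim): lottery ticket; floor = certified bounds/negative ranges.
Census STRUCTURE bookkeeping (question Q7 of the pub-omega cell: the uniform threshold `N_k` = least order from which EVERY
finite abelian group admits `k` simultaneous-TPP triples of 2-subsets, CKSU 2005 Def. 5.1, tree form `IsSTPP`), not progress on
`ω`: a `(2,2,2)^k` family certifies no matrix-multiplication bound of interest.

Decision part C of `N₈ ≤ 257` (headline and assembly in `STPP222Pow8From257.lean`).  Before this chain the kernel's `k = 8` threshold was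
`N₈ ≤ 326` (`STPP222Pow8From326.lean`, stpp-3 gen 12; the seedless `N₈ ≤ 530` of `STPP222Pow8From530.lean` had `530 = 1 + |ℤ/23²|`, merely the
largest abelian type WITHOUT A ROUTE; `326 = 1 + |ℤ/5²×ℤ/13|`, the largest unrouted type then without a witness).
The landed checker `N8Routes.covered8 shapes 8` (`STPP222Pow8Routes.lean`) already accepts seed SHAPES and only reads the
LIST; this chain uses the 8 shapes `[[23,23],[19,19],[5,8,8],[2,8,19],[2,8,17],[5,5,11],[17,17],[5,5,13]]` (the unrouted types of order `≥ 257` for which kernel witnesses exist), written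
LITERALLY in every statement together with the literal capping list `E ↦ (ppList215.filter (· ∣ E)).map (v ↦ (v, c v))`, `c v` = least `c` with
`v ^ c ≥ 257`, so that each decision part imports only long-compiled modules and carries no definition.
KERNEL DECISION of this part: for the exponents `E` listed in each piece, every sub-multiset of the capping multiset with product `≥ 257` passes
the checker (12572 capped multisets here; 258844 of product `≥ 257` over all parts; exponent `≥ 216`: the base-3 cyclic law `exists_isSTPP_222pow_of_exponent_ge_two_pow 3 8` in the final file).
Exact Python mirror and certificate of coverage (0 uncovered): the seat's `modelGs.py` / `gen78v2.py` (HOME `pub-omega-stpp-3-g13/code/gen/`, = gen 12's generators).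

References: H. Cohn, R. Kleinberg, B. Szegedy, C. Umans, FOCS 2005 (arXiv:math/0511460), Def. 5.1; J. Blasiak et al., Discrete
Analysis 2017:3, Def. 3.1.  Seat pub-omega-stpp-3 (gen 13), 2026-08-25.
-/

open Literature.Computability.AlgebraicComplexity Literature.Combinatorics.Additive Finset

namespace Summit.MatrixMultiplication.OmegaCensus

namespace N8From257

open N5Kit N5From94 NkRoutes N8Routes N8From530

set_option Elab.async false

/-! ## Kernel decision pieces -/

/-- Kernel decision piece: exponents `193 ≤ E ≤ 207` (7071 capped multisets). -/
theorem cov_pc_193 : ∀ E ∈ List.range' 193 15, ∀ M ∈ subMS ((ppList215.filter (· ∣ E)).map fun v => (v, if v ≤ 2 then 9 else if v ≤ 3 then 6 else if v ≤ 4 then 5 else if v ≤ 5 then 4 else if v ≤ 16 then 3 else 2)),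
    257 ≤ M.prod → covered8 [[23,23],[19,19],[5,8,8],[2,8,19],[2,8,17],[5,5,11],[17,17],[5,5,13]] 8 M = true := by
  decide +kernel

/-- Kernel decision piece: exponents `208 ≤ E ≤ 215` (5501 capped multisets). -/
theorem cov_pc_208 : ∀ E ∈ List.range' 208 8, ∀ M ∈ subMS ((ppList215.filter (· ∣ E)).map fun v => (v, if v ≤ 2 then 9 else if v ≤ 3 then 6 else if v ≤ 4 then 5 else if v ≤ 5 then 4 else if v ≤ 16 then 3 else 2)),
    257 ≤ M.prod → covered8 [[23,23],[19,19],[5,8,8],[2,8,19],[2,8,17],[5,5,11],[17,17],[5,5,13]] 8 M = true := by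
  decide +kernel

end N8From257

end Summit.MatrixMultiplication.OmegaCensus
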